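import Summits.BirchSwinnertonDyer.BirchSwinnertonDyer.Theorems.SylvesterTwoHeegnerIndexUpperConeOfPrintExactByName
import HarnessLib

/-!
# Route `SylvesterTwoHeegnerIndex` (rung K7t): THEOREM C (item stmt-BirchSwinnertonDyer-19802
# `HSYPointTwoDivisibleSevenModNine`) BY NAME from `PublishedFactsTwoPlus` and the two NAMED prints (G3′) and #19

Seat `leafhand-bsd-sylvestertwoheegne-1` g0 (prover; priority18 refill D-0181(3) step 4; director-bsd (685) rails:
LAND-ONLY, `--supports stmt-BirchSwinnertonDyer-19802 --as helper`).  THEOREMS ONLY: two compositions of landed theorems;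
no definition, no named fact, no instance, no notation, no `sorry`.

WHAT THIS FILE IS.  The by-name § of k7t-c2 g35 (`…Theorems.SylvesterTwoHeegnerIndexUpperConeOfPrintExactByName`, p757855)
states the UPPER cone of K7t — crux 19804, UPPER 19725, the hand item 19229 and the rung leaf — from `PublishedFactsTwoPlus`
and the print-exact NAMED Literature facts {(G3′) `HuShuYin2019.exists_deg_eq_six_isS3Invariant`, #19
`HuShuYin2019.shaAnPair_mul_height_eq_two_zpow_mul_height_named`, #20, VII}; THEOREM C itself (item 19802) is stated there
only against the DISPLAYED stub type of VARIANT S (`SylvesterTwoUpperCone.hsyPointTwoDivisibleSevenModNine_of_printStubs`,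
hypothesis `(∃ Dt, Dt.deg = 6) ∧ #19 ∧ #20 ∧ (G3)`).  This file adds the missing line: the ROUTE DECL of item 19802 BY NAME
from `PublishedFactsTwoPlus` + (G3′) + #19 — every hypothesis a cite-tagged name, #20 (Nekovář) and VII (Cassels–Tate) not
needed, the admitted `∀`-binder (G3) gone (rigidity, `SylvesterTwoUpperCone.thmC_of_isS3Invariant` at the witness of (G3′)).

READING FOR THE REGISTERED SKELETON OF 19802 (S-19802/toric ea25de9eb9afcd52, stubs `stub_publishedFactsTwoPlus :
PublishedFactsTwoPlus`, `stub_yinHeightDisplay : SylvesterTwoYin.YinHeightDisplay` (PREPRINT display),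
`stub_yinToricDecomposition : SylvesterTwoYinToric.YinToricDecomposition` (cell DERIVED claim)): granted the SAME first stub,
the two non-print stubs are REPLACED by two PUBLISHED named facts of Hu–Shu–Yin 2019 (Trans. AMS) — item 19802 ⟸
{`PublishedFactsTwoPlus`, (G3′), #19}, zero research / preprint hypotheses.

HONEST LABEL: CONDITIONAL theorems (print inputs displayed as named hypotheses, none proved here); item 19802 is NOT closed by
this file; `X12.CMAtTwo` is NOT proved; BSD is proved for no curve.

## References
* Y. Hu, J. Shu, H. Yin, *An explicit Gross–Zagier formula related to the Sylvester conjecture*, Trans. AMS 372 (2019)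
  = arXiv:1708.05266: Prop. 2.1 (1) (p. 5 L59–L61, L76), §2.2, §4.1 (p. 10 L59, p. 11 L23), Thm. 1.4, Cor. 4.4,
  display (bsd) p. 12. [HuShuYin2019]
* B. H. Gross, *Kolyvagin's work on modular elliptic curves*, LMS LNS 153 (1991), §3. [GrossLMS1991]
-/

set_option linter.dupNamespace false -- Summits modules are `Summit.<Summit>.<Problem>…` by design
set_option autoImplicit false

noncomputable section

open scoped Classical

open WeierstrassCurve
open Literature.NumberTheory.EllipticCurves Literature.NumberTheory.EllipticCurves.ModularForms
  Literature.NumberTheory.EllipticCurves.HuShuYin2019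
open Summit.BirchSwinnertonDyer.BirchSwinnertonDyer.Theses.SylvesterTwoHeegnerIndex
  hiding HSYPointTwoDivisibleSevenModNine
open Summit.BirchSwinnertonDyer.BirchSwinnertonDyer.Theorems
  Summit.BirchSwinnertonDyer.BirchSwinnertonDyer.Theorems.SylvesterTwoUpperCone

namespace Summit.BirchSwinnertonDyer.BirchSwinnertonDyer.Theorems.SylvesterTwoThmCPrintExact

/-- **THEOREM C (the cell def `SylvesterTwoNonneg.HSYPointTwoDivisibleSevenModNine`) from the NAMED prints (G3′) and #19**,
granted `PublishedFactsTwoPlus`: destructure the print-exact existential (G3′) (a degree-`6`, `⟨w₂₄₃, A⟩`-invariant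
parametrisation datum of `E₉` at level `3⁵` — Hu–Shu–Yin Prop. 2.1 (1) with §4.1) and feed its witness to
`SylvesterTwoUpperCone.thmC_of_isS3Invariant` (level fixing (W2-b) for an invariant datum ∘ the CM half-tower descent).
CONDITIONAL; closes nothing by itself; BSD is proved for no curve.
[cite: HuShuYin2019, Prop. 2.1 (1) (p. 5 L59–L61, L76), §2.2, §4.1 (p. 10 L59, p. 11 L23), display (bsd) p. 12]
[cite: GrossLMS1991, §3] -/
theorem thmC_of_named (hG3' : exists_deg_eq_six_isS3Invariant)
    (hD : shaAnPair_mul_height_eq_two_zpow_mul_height_named) :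
    PublishedFactsTwoPlus → SylvesterTwoNonneg.HSYPointTwoDivisibleSevenModNine := by
  obtain ⟨Dt, hdeg, hS3⟩ := hG3'
  exact thmC_of_isS3Invariant Dt hdeg hD hS3

/-- ★ **The ROUTE DECL of item 19802 `HSYPointTwoDivisibleSevenModNine` BY NAME from `PublishedFactsTwoPlus` (the type of the
registered stub `stub_publishedFactsTwoPlus`) and the two NAMED print facts (G3′) `exists_deg_eq_six_isS3Invariant` and #19
`shaAnPair_mul_height_eq_two_zpow_mul_height_named`** — the 19802 line of the print-exact census (k7t-c2 g34/g35 gave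
19804/19725/19229 by name); the route decl is the cell def inlined verbatim (`Iff.rfl`).  CONDITIONAL; item 19802 is not closed
by this; BSD is proved for no curve.
[cite: HuShuYin2019, Prop. 2.1 (1) (p. 5 L59–L61, L76), §2.2, §4.1 (p. 10 L59, p. 11 L23), Thm. 1.4, Cor. 4.4, display (bsd) p. 12]
[cite: GrossLMS1991, §3] -/
theorem hsyPointTwoDivisibleSevenModNine_of_publishedFactsTwoPlus_of_named
    (hF : Summit.BirchSwinnertonDyer.BirchSwinnertonDyer.Theses.SylvesterTwoHeegnerIndex.PublishedFactsTwoPlus)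
    (hG3' : exists_deg_eq_six_isS3Invariant) (hD : shaAnPair_mul_height_eq_two_zpow_mul_height_named) :
    Summit.BirchSwinnertonDyer.BirchSwinnertonDyer.Theses.SylvesterTwoHeegnerIndex.HSYPointTwoDivisibleSevenModNine :=
  thmC_of_named hG3' hD hF

end Summit.BirchSwinnertonDyer.BirchSwinnertonDyer.Theorems.SylvesterTwoThmCPrintExact

end
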